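import Literature.MathematicalPhysics.QuantumLattice.BdGBondHamiltonianParticleHole
import Literature.MathematicalPhysics.QuantumLattice.LiebFluxPhaseProofs
import HarnessLib

/-!
# Two-sided bounds on the BdG partition function and the quasi-free ground-state energy

Topic `Literature/MathematicalPhysics/QuantumLattice` (family `hubbard`); companion of
`BdGBondHamiltonianParticleHole.lean` (`tr e^{-βH_BdG(τ,Δ,μ)} = e^{-βC} det(1 + e^{-β𝓗})`,
`𝓗 = bdgNambuMatrix τ Δ μ`, `C = Σ_x(τ(x,x) - μ)`, `tr 𝓗 = 0`). For a Hermitian matrix `A` with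
eigenvalues `λ_i` we prove the elementary free-fermion estimates

* `det_one_add_exp_neg_smul_eq_ofReal` — `det(1 + e^{-βA}) = Π_i (1 + e^{-βλ_i})` (real, positive);
* `exp_le_re_det_one_add_exp_neg_smul` / `re_det_one_add_exp_neg_smul_le` —
  `e^{-βm} ≤ det(1 + e^{-βA}) ≤ 2^{|n|} e^{-βm}`, `m = Σ_i min(λ_i, 0)` (the upper bound for `β ≥ 0`):
  the free Fermi gas has ground-state energy `m` (fill the negative levels) and at most `2^{|n|}`
  states; `sum_min_eigenvalues_zero_eq` — `m = (tr A - Σ_i|λ_i|)/2`;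

and deduce for the BdG Hamiltonian with ARBITRARY bond data (Hermitian hopping)

* `partitionFn_bdgBondHamiltonian_eq_ofReal` — `tr e^{-βH_BdG}` is the positive real number
  `e^{-β Re C} Π_i(1 + e^{-βλ_i(𝓗)})`;
* `exp_le_re_partitionFn_bdgBondHamiltonian` / `re_partitionFn_bdgBondHamiltonian_le` —
  **`e^{-β E_qf} ≤ tr e^{-βH_BdG(τ,Δ,μ)} ≤ 4^{|Λ|} e^{-β E_qf}`** with the quasi-free (BCS mean-field)
  ground-state energy **`E_qf = Σ_x (Re τ(x,x) - μ) - ½ Σ_i |λ_i(𝓗)|`** (de Gennes 1966 §5-3,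
  eq. (5-45): `E = Σ_{ξ} ξ - Σ_n E_n + …`; Bach–Lieb–Solovej 1994 Thm 2.3 / §3 for the quasi-free
  energy as `-½ tr|𝓗| + const`). This is the thermal form of "the quasi-free energy of a phase
  texture is `-½ Σ_i|λ_i(H_BdG(θ))|` + const" used by lattice phase-rigidity (coercivity) estimates;
* `groundEnergy_bdgBondHamiltonian` — letting `β → ∞` in the sandwich: **the ground-state energy
  of `H_BdG(τ,Δ,μ)` on Fock space IS `E_qf`** (the BCS mean-field ground-state energy formula), and
  `posSemidef_bdgBondHamiltonian_sub_quasiFreeEnergy` — `H_BdG ≥ E_qf` as an operator.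

All statements fully proved; no definitions, no named facts.

## Mathlib / tree search

REUSED: `partitionFn_bdgBondHamiltonian`, `isHermitian_bdgNambuMatrix`, `trace_bdgNambuMatrix`,
`card_orb`, `exp_neg_mul_groundEnergy_le_partitionFn`, `partitionFn_le_card_mul_exp`,
`posSemidef_sub_groundEnergy` (tree); Mathlib `Matrix.IsHermitian.spectral_theorem`, `Matrix.exp_conj`,
`Matrix.exp_diagonal`, `Matrix.det_conj`, `Matrix.IsHermitian.trace_eq_sum_eigenvalues`,
`Real.exp_sum`, `Finset.prod_le_prod`. Nearest existing: `det_one_add_exp_smul_conj`,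
`posDef_one_add_exp_smul` (tree), `det_one_add_inv_sq_smul_sq` (Summits, same technique).

## References

* P. G. de Gennes, *Superconductivity of Metals and Alloys* (1966), Ch. 5, §5-3. [deGennes1966]
* V. Bach, E. H. Lieb, J. P. Solovej, J. Stat. Phys. 76 (1994) 3, §2–3 (Theorem 2.3). [BachLiebSolovej1994]
* J. Dereziński, C. Gérard, *Mathematics of Quantization and Quantum Fields*, §17.2. [DerezinskiGerard2022]
-/

noncomputable section

namespace Literature.MathematicalPhysics.QuantumLattice

open Matrix Finset HubbardWave0 NormedSpace
open scoped ComplexOrder ComplexConjugate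

/-! ### Free-fermion determinant bounds for a Hermitian one-body matrix -/

section General

variable {n : Type*} [Fintype n] [DecidableEq n]

/-- `det(1 + e^{cA}) = Π_i (1 + e^{cλ_i})` for Hermitian `A` (spectral theorem).
[cite: DerezinskiGerard2022, §17.2] -/
theorem det_one_add_exp_smul_eq_prod {A : Matrix n n ℂ} (hA : A.IsHermitian) (c : ℂ) :
    (1 + exp (c • A)).det = ∏ i, (1 + Complex.exp (c * hA.eigenvalues i)) := by
  set U : Matrix.unitaryGroup n ℂ := hA.eigenvectorUnitary with hU
  set D : Matrix n n ℂ := diagonal (RCLike.ofReal ∘ hA.eigenvalues) with hD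
  have hspec : A = (U : Matrix n n ℂ) * D * star (U : Matrix n n ℂ) := by
    have := hA.spectral_theorem
    rw [Unitary.conjStarAlgAut_apply] at this
    exact this
  have hUinv : (U : Matrix n n ℂ)⁻¹ = star (U : Matrix n n ℂ) :=
    Matrix.inv_eq_left_inv (Unitary.coe_star_mul_self U)
  have hUdet : IsUnit (U : Matrix n n ℂ).det :=
    Matrix.isUnit_det_of_left_inverse (Unitary.coe_star_mul_self U)
  have hUunit : IsUnit (U : Matrix n n ℂ) := (Matrix.isUnit_iff_isUnit_det _).mpr hUdet
  have hcA : c • A = (U : Matrix n n ℂ) * (c • D) * (U : Matrix n n ℂ)⁻¹ := by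
    rw [hUinv, hspec, Matrix.mul_smul, Matrix.smul_mul]
  have hcD : c • D = diagonal (fun i => c * (hA.eigenvalues i : ℂ)) := by
    rw [hD, ← diagonal_smul]
    rfl
  have hexpD : exp (c • D) = diagonal (fun i => Complex.exp (c * (hA.eigenvalues i : ℂ))) := by
    rw [hcD, Matrix.exp_diagonal]
    congr 1
    funext i
    rw [Pi.exp_def, Complex.exp_eq_exp_ℂ]
  have h1 : 1 + (U : Matrix n n ℂ) * exp (c • D) * (U : Matrix n n ℂ)⁻¹ =
      (U : Matrix n n ℂ) * (1 + exp (c • D)) * (U : Matrix n n ℂ)⁻¹ := by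
    rw [Matrix.mul_add, Matrix.add_mul, Matrix.mul_one, Matrix.mul_nonsing_inv _ hUdet]
  rw [hcA, Matrix.exp_conj _ _ hUunit, h1, Matrix.det_conj hUunit, hexpD, ← diagonal_one,
    diagonal_add, det_diagonal]

/-- `det(1 + e^{-βA}) = Π_i (1 + e^{-βλ_i})` as a real number cast to `ℂ`. [folklore] -/
theorem det_one_add_exp_neg_smul_eq_ofReal {A : Matrix n n ℂ} (hA : A.IsHermitian) (β : ℝ) :
    (1 + exp (-(β : ℂ) • A)).det = ((∏ i, (1 + Real.exp (-β * hA.eigenvalues i)) : ℝ) : ℂ) := by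
  rw [show (-(β : ℂ)) = ((-β : ℝ) : ℂ) by push_cast; ring, det_one_add_exp_smul_eq_prod hA]
  push_cast
  ring

/-- One mode: `e^{-β min(λ,0)} ≤ 1 + e^{-βλ}` (any real `β`). [folklore] -/
theorem exp_neg_mul_min_le_one_add_exp (β l : ℝ) :
    Real.exp (-β * min l 0) ≤ 1 + Real.exp (-β * l) := by
  rcases le_or_gt 0 l with h | h
  · rw [min_eq_right h, mul_zero, Real.exp_zero]
    linarith [Real.exp_pos (-β * l)]
  · rw [min_eq_left h.le]
    linarith

/-- One mode: `1 + e^{-βλ} ≤ 2 e^{-β min(λ,0)}` for `β ≥ 0`. [folklore] -/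
theorem one_add_exp_le_two_mul_exp_neg_mul_min {β : ℝ} (hβ : 0 ≤ β) (l : ℝ) :
    1 + Real.exp (-β * l) ≤ 2 * Real.exp (-β * min l 0) := by
  rcases le_or_gt 0 l with h | h
  · rw [min_eq_right h, mul_zero, Real.exp_zero]
    have : Real.exp (-β * l) ≤ 1 := Real.exp_le_one_iff.mpr (by nlinarith)
    linarith
  · rw [min_eq_left h.le]
    have : 1 ≤ Real.exp (-β * l) := Real.one_le_exp (by nlinarith)
    linarith

/-- **Lower bound** `e^{-β Σ_i min(λ_i,0)} ≤ det(1 + e^{-βA})` (the filled Fermi sea alone).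
[folklore] -/
theorem exp_le_re_det_one_add_exp_neg_smul {A : Matrix n n ℂ} (hA : A.IsHermitian) (β : ℝ) :
    Real.exp (-β * ∑ i, min (hA.eigenvalues i) 0) ≤ ((1 + exp (-(β : ℂ) • A)).det).re := by
  rw [det_one_add_exp_neg_smul_eq_ofReal hA β, Complex.ofReal_re, Finset.mul_sum, Real.exp_sum]
  exact Finset.prod_le_prod (fun i _ => (Real.exp_pos _).le)
    fun i _ => exp_neg_mul_min_le_one_add_exp β _

/-- **Upper bound** `det(1 + e^{-βA}) ≤ 2^{|n|} e^{-β Σ_i min(λ_i,0)}` for `β ≥ 0` (at most `2^{|n|}`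
states, each with energy at least that of the filled Fermi sea). [folklore] -/
theorem re_det_one_add_exp_neg_smul_le {A : Matrix n n ℂ} (hA : A.IsHermitian) {β : ℝ}
    (hβ : 0 ≤ β) :
    ((1 + exp (-(β : ℂ) • A)).det).re ≤
      2 ^ Fintype.card n * Real.exp (-β * ∑ i, min (hA.eigenvalues i) 0) := by
  rw [det_one_add_exp_neg_smul_eq_ofReal hA β, Complex.ofReal_re, Finset.mul_sum, Real.exp_sum,
    ← Finset.card_univ, ← Finset.prod_const, ← Finset.prod_mul_distrib]
  exact Finset.prod_le_prod (fun i _ => by positivity)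
    fun i _ => one_add_exp_le_two_mul_exp_neg_mul_min hβ _

/-- `det(1 + e^{-βA})` is a positive real. [folklore] -/
theorem re_det_one_add_exp_neg_smul_pos {A : Matrix n n ℂ} (hA : A.IsHermitian) (β : ℝ) :
    0 < ((1 + exp (-(β : ℂ) • A)).det).re :=
  lt_of_lt_of_le (Real.exp_pos _) (exp_le_re_det_one_add_exp_neg_smul hA β)

/-- `Σ_i min(λ_i, 0) = (tr A - Σ_i |λ_i|)/2` (`min(λ,0) = (λ - |λ|)/2`). [folklore] -/
theorem sum_min_eigenvalues_zero_eq {A : Matrix n n ℂ} (hA : A.IsHermitian) :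
    ∑ i, min (hA.eigenvalues i) 0 = (A.trace.re - ∑ i, |hA.eigenvalues i|) / 2 := by
  have htr : A.trace.re = ∑ i, hA.eigenvalues i := by
    rw [hA.trace_eq_sum_eigenvalues, Complex.re_sum]
    simp
  have hmin : ∀ l : ℝ, min l 0 = (l - |l|) / 2 := by
    intro l
    rcases le_or_gt 0 l with h | h
    · rw [min_eq_right h, abs_of_nonneg h]; ring
    · rw [min_eq_left h.le, abs_of_neg h]; ring
  rw [htr, ← Finset.sum_sub_distrib, Finset.sum_div]
  exact Finset.sum_congr rfl fun i _ => hmin _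

/-- A spectral sum of a Hermitian matrix is a sum over the roots of its characteristic polynomial:
`Σ_i f(λ_i(C)) = Σ_{z ∈ roots(charpoly C)} f(Re z)`. [folklore] -/
theorem sum_comp_eigenvalues_eq_multiset_sum {C : Matrix n n ℂ} (hC : C.IsHermitian) (f : ℝ → ℝ) :
    ∑ i, f (hC.eigenvalues i) = (C.charpoly.roots.map fun z => f z.re).sum := by
  rw [hC.roots_charpoly_eq_eigenvalues, Multiset.map_map, Finset.sum_eq_multiset_sum]
  congr 1

/-- **Spectral sums depend only on the characteristic polynomial**: for Hermitian `A`, `B`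
(possibly indexed by different types) with `charpoly A = charpoly B` and any `f : ℝ → ℝ`,
`Σ_i f(λ_i(A)) = Σ_j f(λ_j(B))`. With `Matrix.charpoly_reindex` this transports `Σ_i |λ_i|`,
`Σ_i min(λ_i,0)` along relabellings such as the Nambu equivalence `Λ ⊕ Λ ≃ Orb Λ`. [folklore] -/
theorem sum_comp_eigenvalues_eq_of_charpoly_eq {m : Type*} [Fintype m] [DecidableEq m]
    {A : Matrix m m ℂ} {B : Matrix n n ℂ} (hA : A.IsHermitian) (hB : B.IsHermitian)
    (h : A.charpoly = B.charpoly) (f : ℝ → ℝ) :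
    ∑ i, f (hA.eigenvalues i) = ∑ j, f (hB.eigenvalues j) := by
  rw [sum_comp_eigenvalues_eq_multiset_sum hA, sum_comp_eigenvalues_eq_multiset_sum hB, h]

/-- In particular `Σ_j |λ_j(reindex e e A)| = Σ_i |λ_i(A)|`. [folklore] -/
theorem sum_abs_eigenvalues_reindex {m : Type*} [Fintype m] [DecidableEq m] (e : m ≃ n)
    {A : Matrix m m ℂ} (hA : A.IsHermitian) (hB : (Matrix.reindex e e A).IsHermitian) :
    ∑ j, |hB.eigenvalues j| = ∑ i, |hA.eigenvalues i| :=
  (sum_comp_eigenvalues_eq_of_charpoly_eq hA hB (Matrix.charpoly_reindex e A).symm (fun x => |x|)).symm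

end General

/-! ### The BdG Hamiltonian: `e^{-βE_qf} ≤ tr e^{-βH_BdG} ≤ 4^{|Λ|} e^{-βE_qf}` -/

section BdG

variable {Λ : Type*} [LinearOrder Λ] [Fintype Λ]

omit [LinearOrder Λ] in
/-- For Hermitian hopping the diagonal amplitudes are real: `τ(x,x) = Re τ(x,x)`. [folklore] -/
theorem sum_diag_sub_eq_ofReal {τ : Λ → Λ → ℂ} (hτ : ∀ x y, star (τ x y) = τ y x) (μ : ℝ) :
    ∑ x : Λ, (τ x x - μ) = ((∑ x : Λ, ((τ x x).re - μ) : ℝ) : ℂ) := by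
  push_cast
  refine Finset.sum_congr rfl fun x _ => ?_
  rw [(Complex.conj_eq_iff_re.mp (hτ x x))]

/-- **The BdG partition function is a positive real number**:
`tr e^{-βH_BdG(τ,Δ,μ)} = e^{-β Σ_x(Re τ(x,x) - μ)} Π_i (1 + e^{-βλ_i(𝓗)})`. [cite: deGennes1966, §5-3] -/
theorem partitionFn_bdgBondHamiltonian_eq_ofReal {τ : Λ → Λ → ℂ} (hτ : ∀ x y, star (τ x y) = τ y x)
    (Δ : Λ → Λ → ℂ) (μ β : ℝ) :
    partitionFn β (bdgBondHamiltonian τ Δ μ) =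
      ((Real.exp (-β * ∑ x : Λ, ((τ x x).re - μ)) *
        ∏ i, (1 + Real.exp (-β * (isHermitian_bdgNambuMatrix hτ Δ μ).eigenvalues i)) : ℝ) : ℂ) := by
  rw [partitionFn_bdgBondHamiltonian hτ Δ μ β,
    det_one_add_exp_neg_smul_eq_ofReal (isHermitian_bdgNambuMatrix hτ Δ μ) β,
    sum_diag_sub_eq_ofReal hτ μ]
  push_cast
  ring

/-- For the traceless Nambu matrix, `Σ_i min(λ_i,0) = -½ Σ_i |λ_i|`. [folklore] -/
theorem sum_min_eigenvalues_bdgNambuMatrix {τ : Λ → Λ → ℂ} (hτ : ∀ x y, star (τ x y) = τ y x)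
    (Δ : Λ → Λ → ℂ) (μ : ℝ) :
    ∑ i, min ((isHermitian_bdgNambuMatrix hτ Δ μ).eigenvalues i) 0 =
      -(∑ i, |(isHermitian_bdgNambuMatrix hτ Δ μ).eigenvalues i|) / 2 := by
  rw [sum_min_eigenvalues_zero_eq, trace_bdgNambuMatrix, Complex.zero_re, zero_sub]

/-- The real part of the BdG partition function, factorised. [folklore] -/
theorem re_partitionFn_bdgBondHamiltonian {τ : Λ → Λ → ℂ} (hτ : ∀ x y, star (τ x y) = τ y x)
    (Δ : Λ → Λ → ℂ) (μ β : ℝ) :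
    (partitionFn β (bdgBondHamiltonian τ Δ μ)).re =
      Real.exp (-β * ∑ x : Λ, ((τ x x).re - μ)) *
        ((1 + exp (-(β : ℂ) • bdgNambuMatrix τ Δ μ)).det).re := by
  rw [partitionFn_bdgBondHamiltonian hτ Δ μ β, sum_diag_sub_eq_ofReal hτ μ,
    show -(β : ℂ) * ((∑ x : Λ, ((τ x x).re - μ) : ℝ) : ℂ) =
      ((-β * ∑ x : Λ, ((τ x x).re - μ) : ℝ) : ℂ) by push_cast; ring,
    ← Complex.ofReal_exp, Complex.re_ofReal_mul]

/-- **Lower bound by the quasi-free ground-state energy**: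
`e^{-β E_qf} ≤ tr e^{-βH_BdG(τ,Δ,μ)}`, `E_qf = Σ_x(Re τ(x,x) - μ) - ½ Σ_i|λ_i(𝓗)|` (any real `β`).
[cite: BachLiebSolovej1994, Theorem 2.3] -/
theorem exp_le_re_partitionFn_bdgBondHamiltonian {τ : Λ → Λ → ℂ}
    (hτ : ∀ x y, star (τ x y) = τ y x) (Δ : Λ → Λ → ℂ) (μ β : ℝ) :
    Real.exp (-β * (∑ x : Λ, ((τ x x).re - μ) -
        (∑ i, |(isHermitian_bdgNambuMatrix hτ Δ μ).eigenvalues i|) / 2)) ≤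
      (partitionFn β (bdgBondHamiltonian τ Δ μ)).re := by
  set S : ℝ := ∑ x : Λ, ((τ x x).re - μ) with hS
  set T : ℝ := ∑ i, |(isHermitian_bdgNambuMatrix hτ Δ μ).eigenvalues i| with hT
  have h := exp_le_re_det_one_add_exp_neg_smul (isHermitian_bdgNambuMatrix hτ Δ μ) β
  rw [sum_min_eigenvalues_bdgNambuMatrix hτ Δ μ, ← hT] at h
  rw [re_partitionFn_bdgBondHamiltonian hτ Δ μ β, ← hS,
    show -β * (S - T / 2) = -β * S + -β * (-T / 2) by ring, Real.exp_add]
  exact mul_le_mul_of_nonneg_left h (Real.exp_pos _).le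

/-- **Upper bound by the quasi-free ground-state energy and the entropy factor**:
`tr e^{-βH_BdG(τ,Δ,μ)} ≤ 4^{|Λ|} e^{-β E_qf}` for `β ≥ 0`. [cite: BachLiebSolovej1994, Theorem 2.3] -/
theorem re_partitionFn_bdgBondHamiltonian_le {τ : Λ → Λ → ℂ}
    (hτ : ∀ x y, star (τ x y) = τ y x) (Δ : Λ → Λ → ℂ) (μ : ℝ) {β : ℝ} (hβ : 0 ≤ β) :
    (partitionFn β (bdgBondHamiltonian τ Δ μ)).re ≤
      4 ^ Fintype.card Λ * Real.exp (-β * (∑ x : Λ, ((τ x x).re - μ) -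
        (∑ i, |(isHermitian_bdgNambuMatrix hτ Δ μ).eigenvalues i|) / 2)) := by
  set S : ℝ := ∑ x : Λ, ((τ x x).re - μ) with hS
  set T : ℝ := ∑ i, |(isHermitian_bdgNambuMatrix hτ Δ μ).eigenvalues i| with hT
  have h := re_det_one_add_exp_neg_smul_le (isHermitian_bdgNambuMatrix hτ Δ μ) hβ
  rw [sum_min_eigenvalues_bdgNambuMatrix hτ Δ μ, ← hT, card_orb, pow_mul,
    show (2 : ℝ) ^ 2 = 4 by norm_num] at h
  rw [re_partitionFn_bdgBondHamiltonian hτ Δ μ β, ← hS,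
    show -β * (S - T / 2) = -β * S + -β * (-T / 2) by ring, Real.exp_add]
  calc Real.exp (-β * S) * ((1 + exp (-(β : ℂ) • bdgNambuMatrix τ Δ μ)).det).re
      ≤ Real.exp (-β * S) * (4 ^ Fintype.card Λ * Real.exp (-β * (-T / 2))) :=
        mul_le_mul_of_nonneg_left h (Real.exp_pos _).le
    _ = 4 ^ Fintype.card Λ * (Real.exp (-β * S) * Real.exp (-β * (-T / 2))) := by ring

/-- **The BdG partition function is positive** (real part `> 0`, imaginary part `0`). [folklore] -/
theorem partitionFn_bdgBondHamiltonian_re_pos_im_zero {τ : Λ → Λ → ℂ}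
    (hτ : ∀ x y, star (τ x y) = τ y x) (Δ : Λ → Λ → ℂ) (μ β : ℝ) :
    0 < (partitionFn β (bdgBondHamiltonian τ Δ μ)).re ∧
      (partitionFn β (bdgBondHamiltonian τ Δ μ)).im = 0 := by
  refine ⟨lt_of_lt_of_le (Real.exp_pos _) (exp_le_re_partitionFn_bdgBondHamiltonian hτ Δ μ β), ?_⟩
  rw [partitionFn_bdgBondHamiltonian_eq_ofReal hτ Δ μ β, Complex.ofReal_im]

/-! ### Transport along a relabelling `Λ ≃ T` of the sites (physics index types without a linear order) -/

/-- **The Nambu matrix of transported bond data is the reindexed BdG block matrix.** Let `e : Λ ≃ T`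
relabel the (linearly ordered, Jordan–Wigner) site set `Λ` by a physics index type `T` (e.g.
`FermionTorus d L ≃ TorusSite d L`), let `τ₀` be a SYMMETRIC hopping matrix and `D` a SYMMETRIC
(singlet, bond) gap matrix on `T`, and `h = τ₀ - μ`. Then the Nambu matrix of the bond data
`τ = τ₀ ∘ e`, `Δ = -½ conj D ∘ e` is `fromBlocks h D Dᴴ (-h)` — de Gennes' BdG matrix in the form used
by the phase-rigidity statement `BirBdGPhaseCoercivity` — reindexed along
`(e⁻¹ ⊕ e⁻¹) ≫ nambuEquiv : T ⊕ T ≃ Orb Λ`. [cite: deGennes1966, §5-1 eq. (5-18)] -/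
theorem bdgNambuMatrix_transport_eq_reindex_fromBlocks {T : Type*} [Fintype T] [DecidableEq T]
    (e : Λ ≃ T) (τ₀ : T → T → ℂ) (hτ₀ : ∀ x y, τ₀ x y = τ₀ y x) (D : Matrix T T ℂ)
    (hD : ∀ x y, D x y = D y x) (μ : ℝ) :
    bdgNambuMatrix (fun u v => τ₀ (e u) (e v)) (fun u v => -(1 / 2 : ℂ) * star (D (e u) (e v))) μ =
      Matrix.reindex ((e.symm.sumCongr e.symm).trans nambuEquiv)
        ((e.symm.sumCongr e.symm).trans nambuEquiv)
        (Matrix.fromBlocks (fun x y => τ₀ x y - (if x = y then (μ : ℂ) else 0)) D Dᴴ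
          (-(fun x y => τ₀ x y - (if x = y then (μ : ℂ) else 0)))) := by
  set E : T ⊕ T ≃ Orb Λ := (e.symm.sumCongr e.symm).trans nambuEquiv with hE
  ext o o'
  obtain ⟨s, rfl⟩ := E.surjective o
  obtain ⟨s', rfl⟩ := E.surjective o'
  rw [reindex_apply, submatrix_apply, Equiv.symm_apply_apply, Equiv.symm_apply_apply]
  rcases s with u | u <;> rcases s' with v | v
  · simp [hE, bdgNambuMatrix_orb_orb]
  · simp [hE, bdgNambuMatrix_orb_orb]
    rw [hD v u]
    ring
  · simp [hE, bdgNambuMatrix_orb_orb]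
    rw [hD v u]
    ring
  · simp [hE, bdgNambuMatrix_orb_orb]
    rw [hτ₀ v u]
    ring

/-- Hence the BdG block matrix `fromBlocks h D Dᴴ (-h)` (symmetric `τ₀` with `conj τ₀(x,y) = τ₀(y,x)`,
symmetric `D`) is Hermitian — the hypothesis the phase-rigidity statement quantifies over. [folklore] -/
theorem isHermitian_fromBlocks_bdg {T : Type*} [Fintype T] [DecidableEq T]
    (e : Λ ≃ T) (τ₀ : T → T → ℂ) (hτ₀ : ∀ x y, τ₀ x y = τ₀ y x)
    (hτ₀' : ∀ x y, star (τ₀ x y) = τ₀ y x) (D : Matrix T T ℂ) (hD : ∀ x y, D x y = D y x) (μ : ℝ) :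
    (Matrix.fromBlocks (fun x y => τ₀ x y - (if x = y then (μ : ℂ) else 0)) D Dᴴ
      (-(fun x y => τ₀ x y - (if x = y then (μ : ℂ) else 0)))).IsHermitian := by
  set E : T ⊕ T ≃ Orb Λ := (e.symm.sumCongr e.symm).trans nambuEquiv with hE
  have hτ : ∀ u v : Λ, star (τ₀ (e u) (e v)) = τ₀ (e v) (e u) := fun u v => hτ₀' _ _
  have h := (isHermitian_bdgNambuMatrix hτ (fun u v => -(1 / 2 : ℂ) * star (D (e u) (e v))) μ).submatrix E
  rw [bdgNambuMatrix_transport_eq_reindex_fromBlocks e τ₀ hτ₀ D hD μ, ← hE] at h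
  simpa only [reindex_apply, submatrix_submatrix, Equiv.symm_comp_self, submatrix_id_id] using h

/-- **Spectral sums of the BdG block matrix are those of the Nambu matrix** of the transported bond
data (any `f`, e.g. `|·|`): `charpoly` is invariant under the reindexing. [folklore] -/
theorem sum_comp_eigenvalues_fromBlocks_bdg_eq {T : Type*} [Fintype T] [DecidableEq T]
    (e : Λ ≃ T) (τ₀ : T → T → ℂ) (hτ₀ : ∀ x y, τ₀ x y = τ₀ y x) (D : Matrix T T ℂ)
    (hD : ∀ x y, D x y = D y x) (μ : ℝ)
    (hB : (Matrix.fromBlocks (fun x y => τ₀ x y - (if x = y then (μ : ℂ) else 0)) D Dᴴ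
      (-(fun x y => τ₀ x y - (if x = y then (μ : ℂ) else 0)))).IsHermitian)
    (hN : (bdgNambuMatrix (fun u v => τ₀ (e u) (e v))
      (fun u v => -(1 / 2 : ℂ) * star (D (e u) (e v))) μ).IsHermitian) (f : ℝ → ℝ) :
    ∑ i, f (hB.eigenvalues i) = ∑ j, f (hN.eigenvalues j) := by
  refine sum_comp_eigenvalues_eq_of_charpoly_eq hB hN ?_ f
  conv_rhs => rw [bdgNambuMatrix_transport_eq_reindex_fromBlocks e τ₀ hτ₀ D hD μ]
  exact (Matrix.charpoly_reindex _ _).symm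

/-! ### The ground-state energy of the BdG Hamiltonian -/

/-- If `β x ≤ c` for every `β > 0` then `x ≤ 0`. [folklore] -/
theorem nonpos_of_forall_pos_mul_le {x c : ℝ} (h : ∀ β : ℝ, 0 < β → β * x ≤ c) : x ≤ 0 := by
  by_contra hx
  push Not at hx
  have hβ : 0 < (|c| + 1) / x := by positivity
  have h1 := h _ hβ
  rw [div_mul_cancel₀ _ hx.ne'] at h1
  linarith [le_abs_self c]

/-- **The BCS mean-field ground-state energy formula.** For Hermitian hopping, the ground-state
energy of the second-quantised BdG Hamiltonian with arbitrary bond data is the quasi-free energy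
`E₀(H_BdG(τ,Δ,μ)) = Σ_x (Re τ(x,x) - μ) - ½ Σ_i |λ_i(𝓗)|`, `𝓗 = bdgNambuMatrix τ Δ μ`
(`β → ∞` in `e^{-βE_qf} ≤ tr e^{-βH} ≤ 4^{|Λ|}e^{-βE_qf}` against `e^{-βE₀} ≤ tr e^{-βH} ≤ D e^{-βE₀}`).
de Gennes 1966 §5-3 eq. (5-45); Bach–Lieb–Solovej 1994 Thm 2.3. [cite: deGennes1966, §5-3] -/
theorem groundEnergy_bdgBondHamiltonian {τ : Λ → Λ → ℂ} (hτ : ∀ x y, star (τ x y) = τ y x)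
    (Δ : Λ → Λ → ℂ) (μ : ℝ) :
    (bdgBondHamiltonian τ Δ μ).groundEnergy =
      ∑ x : Λ, ((τ x x).re - μ) - (∑ i, |(isHermitian_bdgNambuMatrix hτ Δ μ).eigenvalues i|) / 2 := by
  have hH : (bdgBondHamiltonian τ Δ μ).IsHermitian := isHermitian_bdgBondHamiltonian hτ Δ μ
  set E : ℝ := ∑ x : Λ, ((τ x x).re - μ) -
    (∑ i, |(isHermitian_bdgNambuMatrix hτ Δ μ).eigenvalues i|) / 2 with hE
  have hD : (0 : ℝ) < Fintype.card (Finset (Orb Λ)) := by exact_mod_cast Fintype.card_pos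
  have h1 : (bdgBondHamiltonian τ Δ μ).groundEnergy - E ≤ 0 := by
    refine nonpos_of_forall_pos_mul_le (c := Real.log (Fintype.card (Finset (Orb Λ)))) ?_
    intro β hβ
    have ha := exp_le_re_partitionFn_bdgBondHamiltonian hτ Δ μ β
    rw [← hE] at ha
    have hb := partitionFn_le_card_mul_exp hH hβ.le
    have h := Real.log_le_log (Real.exp_pos _) (ha.trans hb)
    rw [Real.log_mul hD.ne' (Real.exp_pos _).ne', Real.log_exp, Real.log_exp] at h
    linarith
  have h2 : E - (bdgBondHamiltonian τ Δ μ).groundEnergy ≤ 0 := by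
    refine nonpos_of_forall_pos_mul_le (c := Real.log (4 ^ Fintype.card Λ)) ?_
    intro β hβ
    have ha := exp_neg_mul_groundEnergy_le_partitionFn hH β
    have hb := re_partitionFn_bdgBondHamiltonian_le hτ Δ μ hβ.le
    rw [← hE] at hb
    have h4 : (0 : ℝ) < 4 ^ Fintype.card Λ := by positivity
    have h := Real.log_le_log (Real.exp_pos _) (ha.trans hb)
    rw [Real.log_mul h4.ne' (Real.exp_pos _).ne', Real.log_exp, Real.log_exp] at h
    linarith
  linarith

/-- **`H_BdG ≥ E_qf`**: the BdG Hamiltonian minus its quasi-free energy is positive semidefinite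
(algebraically: `H - E_qf = Σ_k E_k γ†_kγ_k ≥ 0` in Bogoliubov quasi-particles).
[cite: BachLiebSolovej1994, Theorem 2.3] -/
theorem posSemidef_bdgBondHamiltonian_sub_quasiFreeEnergy {τ : Λ → Λ → ℂ}
    (hτ : ∀ x y, star (τ x y) = τ y x) (Δ : Λ → Λ → ℂ) (μ : ℝ) :
    (bdgBondHamiltonian τ Δ μ - algebraMap ℝ (Matrix (Finset (Orb Λ)) (Finset (Orb Λ)) ℂ)
      (∑ x : Λ, ((τ x x).re - μ) -
        (∑ i, |(isHermitian_bdgNambuMatrix hτ Δ μ).eigenvalues i|) / 2)).PosSemidef := by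
  rw [← groundEnergy_bdgBondHamiltonian hτ Δ μ]
  exact posSemidef_sub_groundEnergy (isHermitian_bdgBondHamiltonian hτ Δ μ)

end BdG

end Literature.MathematicalPhysics.QuantumLattice

end
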